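import Mathlib
import Summits.MatrixMultiplication.MatrixMultiplication.Theses.ProbeRankThreshold

/-!
# `FourthMomentPacking` — TPP triples pack into the fourth moment of the block degrees
(route ProbeRankThreshold, item stmt-MatrixMultiplication-7966)

If a group `G` contains a triple-product-property (TPP) triple `(S, T, U)` and its complex group
algebra is a product of matrix blocks, `ℂ[G] ≃ₐ[ℂ] Π i, M_{d i}(ℂ)`, then
`|S| · |T| · |U| ≤ ∑ i, (d i)^4`.

Proof (the X-rank flattening of the Cohn–Umans embedding, written as ONE matrix factorisation).
Put `ρ g := e (of g)` (a multiplicative map `G → Π i, M_{d i}(ℂ)`) and let `λ` be the linear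
functional "coefficient of `1 ∈ G`" transported through `e`, so that `λ (ρ g) = [g = 1]`.  By the
TPP, for `x x' ∈ S`, `y y' ∈ T`, `z z' ∈ U`,
`[x = x' ∧ y' = y ∧ z = z'] = [x⁻¹ y y'⁻¹ z z'⁻¹ x' = 1] = λ (ρ x⁻¹ · ρ y · ρ (y'⁻¹ z) · ρ (z'⁻¹ x'))`.
The product inside `λ` is block-diagonal, and on block `i` the expression is bilinear in the pair
`(ρ x⁻¹)_i, (ρ (y'⁻¹ z))_i` (which depends only on the ROW index `(x, y', z)`) with coefficients
depending only on the COLUMN index `(x', y, z')`.  Hence the identity matrix on `S × T × U`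
factors as `L * R` through the index type `Σ i, (Fin (d i))⁴`, and
`|S||T||U| = rank 1 ≤ rank L ≤ ∑ i, (d i)^4`.  (Equivalently: the `∑ i, (d i)^3` rank-one terms
of `⊕ i ⟨d i, d i, d i⟩` restrict to triads of `⟨|S|,|T|,|U|⟩` whose X-probes have rank `≤ d i`,
and the X-rank law `∑ rank ≥ |S||T||U|` applies; refines Cohn–Umans 2003, Lemma 3.1 / Thm 4.1 and
Neumann 2011, Obs. 4.1.)  Finiteness of `G` is not used.  No definitions are declared: `ρ`, `λ`
and the two factors are local `set`s of the main proof.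
-/

set_option linter.dupNamespace false

noncomputable section

open Matrix

namespace Summit.MatrixMultiplication.MatrixMultiplication.Theorems

namespace FourthMomentPackingProof

/-! ### A bilinear expansion of a functional of a fourfold matrix product -/

/-- For a linear functional `φ` on `k × k` matrices, `φ (A B C D)` expanded bilinearly in the
entries of `A` and `C` along the elementary matrices `single a f 1`, `single c d 1`. -/
theorem functional_mul_four_expand {k : ℕ} (φ : Matrix (Fin k) (Fin k) ℂ →ₗ[ℂ] ℂ)
    (A B C D : Matrix (Fin k) (Fin k) ℂ) :
    φ (A * B * C * D) =
      ∑ a, ∑ f, ∑ c, ∑ d, A a f * C c d * φ (single a f 1 * B * single c d 1 * D) := by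
  conv_lhs => rw [matrix_eq_sum_single A]
  simp only [Finset.sum_mul, map_sum]
  refine Finset.sum_congr rfl fun a _ => Finset.sum_congr rfl fun f _ => ?_
  conv_lhs => rw [matrix_eq_sum_single C]
  simp only [Finset.mul_sum, Finset.sum_mul, map_sum]
  refine Finset.sum_congr rfl fun c _ => Finset.sum_congr rfl fun d _ => ?_
  have h1 : single a f (A a f) = A a f • single a f (1 : ℂ) := by
    rw [smul_single, smul_eq_mul, mul_one]
  have h2 : single c d (C c d) = C c d • single c d (1 : ℂ) := by
    rw [smul_single, smul_eq_mul, mul_one]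
  rw [h1, h2]
  simp only [smul_mul_assoc, mul_smul_comm, map_smul, smul_eq_mul]
  ring

/-! ### The Cohn–Umans embedding, flattened -/

variable {G : Type*} [Group G]

/-- The TPP in conjugated form: for `x x' ∈ S`, `y y' ∈ T`, `z z' ∈ U`,
`x⁻¹ y (y'⁻¹ z) (z'⁻¹ x') = 1` holds exactly when `x = x'`, `y' = y` and `z = z'`. -/
theorem tpp_iff (S T U : Finset G)
    (hTPP : ∀ s ∈ S, ∀ s' ∈ S, ∀ t ∈ T, ∀ t' ∈ T, ∀ u ∈ U, ∀ u' ∈ U,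
      s * s'⁻¹ * (t * t'⁻¹) * (u * u'⁻¹) = 1 → s = s' ∧ t = t' ∧ u = u')
    (x x' : S) (y y' : T) (z z' : U) :
    ((x, y', z) : S × T × U) = (x', y, z') ↔
      (x : G)⁻¹ * y * ((y' : G)⁻¹ * z) * ((z' : G)⁻¹ * x') = 1 := by
  constructor
  · intro h
    simp only [Prod.mk.injEq] at h
    obtain ⟨rfl, rfl, rfl⟩ := h
    group
  · intro h
    have hconj : (x' : G) * (x : G)⁻¹ * ((y : G) * (y' : G)⁻¹) * ((z : G) * (z' : G)⁻¹) =
        (x' : G) * ((x : G)⁻¹ * y * ((y' : G)⁻¹ * z) * ((z' : G)⁻¹ * x')) * (x' : G)⁻¹ := by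
      group
    rw [h, mul_one, mul_inv_cancel] at hconj
    obtain ⟨h1, h2, h3⟩ := hTPP _ x'.2 _ x.2 _ y.2 _ y'.2 _ z.2 _ z'.2 hconj
    simp only [Prod.mk.injEq]
    exact ⟨Subtype.ext h1.symm, Subtype.ext h2.symm, Subtype.ext h3⟩

/-- **Main inequality.** If `(S, T, U)` is a TPP triple of `G` and
`e : ℂ[G] ≃ₐ[ℂ] Π i, M_{d i}(ℂ)`, then `|S| · |T| · |U| ≤ ∑ i, (d i)^4`: the identity matrix on
`S × T × U` factors through the index type `Σ i, (Fin (d i))⁴`. -/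
theorem card_mul_card_mul_card_le {r : ℕ} {d : Fin r → ℕ}
    (e : MonoidAlgebra ℂ G ≃ₐ[ℂ] (Π i : Fin r, Matrix (Fin (d i)) (Fin (d i)) ℂ))
    (S T U : Finset G)
    (hTPP : ∀ s ∈ S, ∀ s' ∈ S, ∀ t ∈ T, ∀ t' ∈ T, ∀ u ∈ U, ∀ u' ∈ U,
      s * s'⁻¹ * (t * t'⁻¹) * (u * u'⁻¹) = 1 → s = s' ∧ t = t' ∧ u = u') :
    S.card * T.card * U.card ≤ ∑ i, d i ^ 4 := by
  classical
  -- the block representation `ρ g = e (of g)`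
  set ρ : G →* (Π i : Fin r, Matrix (Fin (d i)) (Fin (d i)) ℂ) :=
    (e : MonoidAlgebra ℂ G →ₐ[ℂ] (Π i : Fin r, Matrix (Fin (d i)) (Fin (d i)) ℂ)).toMonoidHom.comp
      (MonoidAlgebra.of ℂ G) with hρ_def
  have hρ : ∀ g : G, ρ g = e (MonoidAlgebra.of ℂ G g) := fun g => rfl
  -- the functional "coefficient of `1 ∈ G`", transported through `e`
  set lam : (Π i : Fin r, Matrix (Fin (d i)) (Fin (d i)) ℂ) →ₗ[ℂ] ℂ :=
    Finsupp.lapply (1 : G) ∘ₗ (MonoidAlgebra.coeffLinearEquiv ℂ).toLinearMap ∘ₗ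
      e.symm.toLinearEquiv.toLinearMap with hlam_def
  have hlam : ∀ X, lam X = (e.symm X).coeff 1 := fun X => rfl
  have lam_rho : ∀ g : G, lam (ρ g) = if g = 1 then 1 else 0 := by
    intro g
    rw [hlam, hρ, AlgEquiv.symm_apply_apply, MonoidAlgebra.of_apply, MonoidAlgebra.coeff_single,
      Finsupp.single_apply]
  -- `λ` splits over the blocks
  have lam_blocks : ∀ X : Π i : Fin r, Matrix (Fin (d i)) (Fin (d i)) ℂ,
      lam X = ∑ i, lam (Pi.single i (X i)) := by
    intro X
    conv_lhs => rw [← Finset.univ_sum_single X]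
    rw [map_sum]
  -- the two factors: row `(x, y', z)`, inner `⟨i, a, f, c, d⟩`, column `(x', y, z')`
  set L : Matrix (S × T × U) (Σ i : Fin r, Fin (d i) × Fin (d i) × Fin (d i) × Fin (d i)) ℂ :=
    Matrix.of fun x j => ρ ((x.1 : G)⁻¹) j.1 j.2.1 j.2.2.1 *
      ρ ((x.2.1 : G)⁻¹ * (x.2.2 : G)) j.1 j.2.2.2.1 j.2.2.2.2 with hL
  set R : Matrix (Σ i : Fin r, Fin (d i) × Fin (d i) × Fin (d i) × Fin (d i)) (S × T × U) ℂ :=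
    Matrix.of fun j y => lam (Pi.single j.1
      (single j.2.1 j.2.2.1 (1 : ℂ) * ρ (y.2.1 : G) j.1 * single j.2.2.2.1 j.2.2.2.2 (1 : ℂ) *
        ρ ((y.2.2 : G)⁻¹ * (y.1 : G)) j.1)) with hR
  -- the factorisation of the identity matrix
  have key : (1 : Matrix (S × T × U) (S × T × U) ℂ) = L * R := by
    ext ⟨x, y', z⟩ ⟨x', y, z'⟩
    rw [Matrix.one_apply, Matrix.mul_apply, if_congr (tpp_iff S T U hTPP x x' y y' z z') rfl rfl,
      ← lam_rho]
    have hprod : ρ ((x : G)⁻¹ * y * ((y' : G)⁻¹ * z) * ((z' : G)⁻¹ * x')) =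
        ρ (x : G)⁻¹ * ρ (y : G) * ρ ((y' : G)⁻¹ * z) * ρ ((z' : G)⁻¹ * x') := by
      simp only [map_mul]
    rw [hprod, lam_blocks, Fintype.sum_sigma]
    refine Finset.sum_congr rfl fun i _ => ?_
    have hexp := functional_mul_four_expand
      (lam ∘ₗ LinearMap.single ℂ (fun j : Fin r => Matrix (Fin (d j)) (Fin (d j)) ℂ) i)
      (ρ (x : G)⁻¹ i) (ρ (y : G) i) (ρ ((y' : G)⁻¹ * z) i) (ρ ((z' : G)⁻¹ * x') i)
    simp only [LinearMap.comp_apply, LinearMap.coe_single] at hexp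
    simp only [Pi.mul_apply]
    rw [hexp]
    simp only [Fintype.sum_prod_type, hL, hR, Matrix.of_apply]
  -- rank bookkeeping
  calc S.card * T.card * U.card = Fintype.card (S × T × U) := by
        simp only [Fintype.card_prod, Fintype.card_coe, mul_assoc]
    _ = (1 : Matrix (S × T × U) (S × T × U) ℂ).rank := Matrix.rank_one.symm
    _ = (L * R).rank := by rw [← key]
    _ ≤ L.rank := Matrix.rank_mul_le_left _ _
    _ ≤ Fintype.card (Σ i : Fin r, Fin (d i) × Fin (d i) × Fin (d i) × Fin (d i)) :=
        Matrix.rank_le_card_width _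
    _ = ∑ i, d i ^ 4 := by
        simp only [Fintype.card_sigma, Fintype.card_prod, Fintype.card_fin]
        exact Finset.sum_congr rfl fun i _ => by ring

end FourthMomentPackingProof

open FourthMomentPackingProof in
/-- **`FourthMomentPacking`** (item stmt-MatrixMultiplication-7966): if a finite group `G`
realises `⟨n, m, p⟩` through a TPP triple and `ℂ[G] ≃ₐ[ℂ] Π i, M_{d i}(ℂ)`, then
`n · m · p ≤ ∑ i, (d i)^4` (X-rank flattening of the Cohn–Umans embedding). -/
theorem fourthMomentPacking_proof : Theses.ProbeRankThreshold.FourthMomentPacking := by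
  intro G _ _ n m p hSTU r d he
  obtain ⟨S, T, U, rfl, rfl, rfl, hTPP⟩ := hSTU
  obtain ⟨e⟩ := he
  exact card_mul_card_mul_card_le e S T U hTPP

end Summit.MatrixMultiplication.MatrixMultiplication.Theorems
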